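import Literature.Probability.Percolation.TwoSetConditionalAssociationRC
import Literature.Probability.Percolation.KozmaNitzanClusterPropertyReal
import HarnessLib

/-!
# FK sub-lane: the tower property along `σ(C_b)` for `φ_{w,q}` — the Kozma–Nitzan functional `F(C(b)) − F(C(a))`
# projected on the owner's edge cluster (vdBHK Lemma 2.4 for the random-cluster measure)

Support file (`--supports stmt-CriticalPhenomena-4575`), FK sub-lane `prim-bschramm-fk-2` (gen 5) of the post-continuity programme;
builds on p205010 (kernel theorem, internal audit signed; external expert review pending).  No definitions, no named facts, no sorries;
standard axioms.  The random-cluster twin (`φ_{w,q} = rcMeasureW w q ∅`, cluster weight `q > 0`; monotonicity for `q ≥ 1`) of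
prim-gen-induct's `…NoHeavyLowerTailCovTauTransfer.lean` (`CovTau.tower_clusterFun`, `CovTau.antitone_condMean`,
`CovTau.monotone_projFun`, `CovTau.setIntegral_sub_eq_projFun`), which is the projection step of the tree's proof of Kozma–Nitzan's
Conjecture 4 from the conditioned slack hierarchy (`PreFKGSurplus.kn_conj4_of_csh`).

On `D = {b ↮ a}`, given `C_b = K` the configuration off the pairs `K̄` meeting `{b} ∪ V(K)` is distributed according to the
random-cluster measure with the SAME `q` on `G − K̄` (vdBHK Lemma 2.3/2.4 for `φ_{p,q}`; tree: `BHK2006.rc_set_sum_cond_cluster`), and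
the cluster of `a` lives off `K̄`.  Hence

* `FK.tower_clusterFun_rc` (`0 < q`) — `∫_{D ∩ {C_b ∈ 𝒮}} F(C(a)) dφ = ∫_{D ∩ {C_b ∈ 𝒮}} g(C_b) dφ` with the WORLD MEAN
  `g(K) = ∫ F(C_a) dφ_{G−K̄,q}`, `φ_{G−K̄,q} = rcMeasureW (delW w (barOf {b} K)) q ∅`;
* `FK.antitone_condMean_rc` (`1 ≤ q`) — `g` is decreasing in `K` (more deleted pairs ⇒ stochastically smaller, Grimmett (3.22) /
  vdBHK display (16); tree `BHK2006.sum_rcMass_mono_weights`);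
* `FK.monotone_projFun_rc` — the projected functional `f(K) = F({b} ∪ V(K)) − g(K)` is a MONOTONE function of the owner's edge cluster;
* `FK.setIntegral_sub_eq_projFun_rc` — `∫ (F(C(b)) − F(C(a))) dφ = ∫ f(C_b) dφ` on the `σ(C_b)`-events inside `D`.
[cite: VandenbergHaggstromKahn2005, §2.1 Lemmas 2.3–2.4 (p. 10), display (16) (p. 12)] [cite: Grimmett2006, §1.4 eq. (1.20) (p. 15); eq. (3.22)]
[cite: KozmaNitzan2024, Conj. 4 (p. 32), §5.1 (p. 31)]
-/

noncomputable section

namespace Summit.CriticalPhenomena.PercolationContinuityZ3.Theorems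

open MeasureTheory Set Literature.Probability.LatticeModels Literature.Probability.Percolation
open scoped Classical
open KNPreFKG BHK2006 DecisionTree

namespace FK

variable {V : Type*} [Fintype V]

/-- **Tower property along `σ(C_b)` on `{b ↮ a}` for `φ_{w,q}`, `q > 0` (vdBHK Lemma 2.4 for the random-cluster measure).**
For any `F` on vertex sets and any family `𝒮` of edge sets:
`∫_{D ∩ {C_b ∈ 𝒮}} F(C(a)) dφ = ∫_{D ∩ {C_b ∈ 𝒮}} g(C_b) dφ` with `D = {b ↮ a}` and the world mean
`g(K) = ∫ F(C_a(η)) dφ_{G−K̄,q}(η)`, `K̄ = barOf {b} K` the pairs meeting `{b} ∪ V(K)` — given `C_b = K` (inside `D`) the cluster of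
`a` is the cluster of `a` under the random-cluster measure with the same `q` on `G` minus the pairs meeting the cluster of `b`.
[cite: VandenbergHaggstromKahn2005, §2.1 Lemma 2.4 (p. 10)] [cite: Grimmett2006, §1.4 eq. (1.20) (p. 15)] -/
theorem tower_clusterFun_rc (w : Sym2 V → unitInterval) {q : ℝ} (hq : 0 < q) (a b : V) (F : Set V → ℝ)
    (𝒮 : Set (Set (Sym2 V))) :
    ∫ ω in {ω : BondConfig V | ¬ (openGraph ω).Reachable b a} ∩ {ω | openEdgeCluster ω b ∈ 𝒮},
        F (openCluster ω a) ∂(rcMeasureW w q ∅) =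
      ∫ ω in {ω : BondConfig V | ¬ (openGraph ω).Reachable b a} ∩ {ω | openEdgeCluster ω b ∈ 𝒮},
        (∫ η, F (openCluster η a) ∂(rcMeasureW (delW w (barOf {b} (openEdgeCluster ω b))) q ∅))
          ∂(rcMeasureW w q ∅) := by
  classical
  set D : Set (BondConfig V) := {ω : BondConfig V | ¬ (openGraph ω).Reachable b a} with hD
  have hDiff : ∀ ω : BondConfig V, ω ∈ D ↔ ∀ s ∈ ({b} : Set V), ∀ t ∈ ({a} : Set V),
      ¬ (openGraph ω).Reachable s t := by
    intro ω; simp [hD]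
  -- the two-cluster identity with `H(K, L) = 1_𝒮(K) · F(V_a(L))`
  have key := rc_set_sum_cond_cluster w hq ({b} : Set V) ({a} : Set V)
    (fun K L => ind 𝒮 K * F {z | z = a ∨ ∃ e ∈ L, z ∈ e}) hDiff
  simp only [setCl_singleton] at key
  have hvert : ∀ η : BondConfig V, F {z | z = a ∨ ∃ e ∈ openEdgeCluster η a, z ∈ e} = F (openCluster η a) :=
    fun η => clusterFun_openEdgeCluster F η a
  simp only [hvert] at key
  -- rewrite both sides as sums against the point masses
  rw [setIntegral_rcMeasureW_eq_sum w hq, setIntegral_rcMeasureW_eq_sum w hq]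
  have hL : ∀ ω : BondConfig V, F (openCluster ω a) * ind (D ∩ {ω | openEdgeCluster ω b ∈ 𝒮}) ω =
      ind 𝒮 (openEdgeCluster ω b) * F (openCluster ω a) * ind D ω := by
    intro ω
    by_cases h1 : ω ∈ D
    · by_cases h2 : openEdgeCluster ω b ∈ 𝒮
      · rw [ind_of_mem (show ω ∈ D ∩ {ω | openEdgeCluster ω b ∈ 𝒮} from ⟨h1, h2⟩), ind_of_mem h1, ind_of_mem h2]; ring
      · rw [ind_of_not_mem (show ω ∉ D ∩ {ω | openEdgeCluster ω b ∈ 𝒮} from fun h => h2 h.2), ind_of_not_mem h2]; ring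
    · rw [ind_of_not_mem (show ω ∉ D ∩ {ω | openEdgeCluster ω b ∈ 𝒮} from fun h => h1 h.1), ind_of_not_mem h1]; ring
  have hR : ∀ ω : BondConfig V,
      (∫ η, F (openCluster η a) ∂(rcMeasureW (delW w (barOf {b} (openEdgeCluster ω b))) q ∅)) *
          ind (D ∩ {ω | openEdgeCluster ω b ∈ 𝒮}) ω =
        (∑ η : BondConfig V, rcMass (delW w (barOf {b} (openEdgeCluster ω b))) q η *
          (ind 𝒮 (openEdgeCluster ω b) * F (openCluster η a))) * ind D ω := by
    intro ω
    have hint : ∫ η, F (openCluster η a) ∂(rcMeasureW (delW w (barOf {b} (openEdgeCluster ω b))) q ∅) =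
        ∑ η : BondConfig V, rcMass (delW w (barOf {b} (openEdgeCluster ω b))) q η * F (openCluster η a) :=
      integral_rcMeasureW_eq_sum _ hq _
    by_cases h1 : ω ∈ D
    · by_cases h2 : openEdgeCluster ω b ∈ 𝒮
      · rw [ind_of_mem (show ω ∈ D ∩ {ω | openEdgeCluster ω b ∈ 𝒮} from ⟨h1, h2⟩), ind_of_mem h1, ind_of_mem h2, hint]
        simp only [one_mul, mul_one]
      · rw [ind_of_not_mem (show ω ∉ D ∩ {ω | openEdgeCluster ω b ∈ 𝒮} from fun h => h2 h.2), ind_of_not_mem h2]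
        simp only [zero_mul, mul_zero, Finset.sum_const_zero]
    · rw [ind_of_not_mem (show ω ∉ D ∩ {ω | openEdgeCluster ω b ∈ 𝒮} from fun h => h1 h.1), ind_of_not_mem h1]; ring
  simp only [hL, hR]
  exact key

/-- **The world mean `K ↦ ∫ F(C_a) dφ_{G−K̄,q}` is decreasing** (`q ≥ 1`, `F` monotone on vertex sets): `K ⊆ K'` deletes more pairs,
`φ_{G−K̄',q} ≤_{st} φ_{G−K̄,q}` (comparison in the edge parameters, Grimmett (3.22); vdBHK display (16)), and `F(C_a)` is increasing.
[cite: VandenbergHaggstromKahn2005, §2.1 display (16) (p. 12)] [cite: Grimmett2006, eq. (3.22)] -/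
theorem antitone_condMean_rc (w : Sym2 V → unitInterval) {q : ℝ} (hq : 1 ≤ q) (a b : V) (F : Set V → ℝ)
    (hF : ∀ S T : Set V, S ⊆ T → F S ≤ F T) :
    Antitone fun K : Set (Sym2 V) => ∫ η, F (openCluster η a) ∂(rcMeasureW (delW w (barOf {b} K)) q ∅) := by
  intro K K' hKK'
  have hq0 : 0 < q := one_pos.trans_le hq
  show ∫ η, F (openCluster η a) ∂(rcMeasureW (delW w (barOf {b} K')) q ∅) ≤
    ∫ η, F (openCluster η a) ∂(rcMeasureW (delW w (barOf {b} K)) q ∅)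
  rw [integral_rcMeasureW_eq_sum _ hq0, integral_rcMeasureW_eq_sum _ hq0]
  refine sum_rcMass_mono_weights (fun e => delW_anti w (barOf_mono {b} hKK') e) hq ?_
  intro η η' hηη'
  exact hF _ _ (openCluster_mono hηη' a)

/-- **The Kozma–Nitzan functional projected on `σ(C_b)` is MONOTONE** (`q ≥ 1`): `f(K) = F({b} ∪ V(K)) − ∫ F(C_a) dφ_{G−K̄,q}`.
[cite: KozmaNitzan2024, §5.1 (p. 31)] [cite: VandenbergHaggstromKahn2005, §2.1 display (16) (p. 12)] -/
theorem monotone_projFun_rc (w : Sym2 V → unitInterval) {q : ℝ} (hq : 1 ≤ q) (a b : V) (F : Set V → ℝ)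
    (hF : ∀ S T : Set V, S ⊆ T → F S ≤ F T) :
    Monotone fun K : Set (Sym2 V) => F {z | z = b ∨ ∃ e ∈ K, z ∈ e} -
      ∫ η, F (openCluster η a) ∂(rcMeasureW (delW w (barOf {b} K)) q ∅) :=
  fun _ _ hKK' => sub_le_sub (monotone_clusterFun b F hF hKK') (antitone_condMean_rc w hq a b F hF hKK')

/-- **The projection identity for `φ_{w,q}`** (`q > 0`): on `D ∩ {C_b ∈ 𝒮}` (`D = {b ↮ a}`),
`∫ (F(C(b)) − F(C(a))) dφ = ∫ f(C_b) dφ` with `f` the projected functional of `monotone_projFun_rc`.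
[cite: VandenbergHaggstromKahn2005, §2.1 Lemma 2.4 (p. 10)] -/
theorem setIntegral_sub_eq_projFun_rc (w : Sym2 V → unitInterval) {q : ℝ} (hq : 0 < q) (a b : V) (F : Set V → ℝ)
    (𝒮 : Set (Set (Sym2 V))) :
    ∫ ω in {ω : BondConfig V | ¬ (openGraph ω).Reachable b a} ∩ {ω | openEdgeCluster ω b ∈ 𝒮},
        (F (openCluster ω b) - F (openCluster ω a)) ∂(rcMeasureW w q ∅) =
      ∫ ω in {ω : BondConfig V | ¬ (openGraph ω).Reachable b a} ∩ {ω | openEdgeCluster ω b ∈ 𝒮},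
        (F {z | z = b ∨ ∃ e ∈ openEdgeCluster ω b, z ∈ e} -
          ∫ η, F (openCluster η a) ∂(rcMeasureW (delW w (barOf {b} (openEdgeCluster ω b))) q ∅))
          ∂(rcMeasureW w q ∅) := by
  haveI := isProbabilityMeasure_rcMeasureW w hq (∅ : Set V)
  rw [integral_sub (Integrable.of_finite).integrableOn (Integrable.of_finite).integrableOn,
    integral_sub (Integrable.of_finite).integrableOn (Integrable.of_finite).integrableOn,
    tower_clusterFun_rc w hq]
  simp only [clusterFun_openEdgeCluster]

end FK

end Summit.CriticalPhenomena.PercolationContinuityZ3.Theorems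

end
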